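import Literature.Probability.RandomPlanarGeometry.HexSAWBrickWallWalks
import Literature.Probability.RandomPlanarGeometry.HexSAWBrickWallPieces
import Literature.Probability.RandomPlanarGeometry.SAWUnfoldingTwoSided
import Literature.Probability.RandomPlanarGeometry.SAWAdsorptionArchUnfolding
import Literature.Probability.RandomPlanarGeometry.SAWBridgeRenewalEquation
import Literature.Probability.RandomPlanarGeometry.HexSAWHammersleyWelshSix
import Mathlib.Analysis.Subadditive
import Mathlib.Analysis.SpecialFunctions.Pow.Real
import HarnessLib

/-!
# Honeycomb SAW at a surface, brick-wall frame, I: wall bridges, their growth rate `β(y)`, and the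
# Hammersley–Torrie–Whittington inequalities `A_n(y) ≤ e^{6√n} B^w_n(y)`, `C^w_n(y) ≤ Σ_k A_k(y) c_{n-k}`

Topic `Literature/Probability/RandomPlanarGeometry` (lane pcv-sawmu, door S1 «HEX-YC-LIMIT-ALL-Y»: the existence of
`μ(y) = lim_n C_n^+(y)^{1/n}` for EVERY `y > 0`, Beaton–Bousquet-Mélou–de Gier–Duminil-Copin–Guttmann 2014, Prop. 5,
"proved by Hammersley, Torrie and Whittington [HTW82] for the hypercubic lattice … the arguments apply mutatis mutandis to the
honeycomb lattice").  This file is the COMBINATORIAL half, written entirely in the brick-wall model of the honeycomb lattice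
(`brickWallGraph`, vertex functions `HexBW.saws n` of `HexSAWBrickWallWalks.lean`) with the adsorbing surface the ROW `Y = 0` and the
half-plane `Y ≤ 0`; the identification with Duminil-Copin–Smirnov's half-plane `{lev ≥ 0}` and the weights `C_n(y) = hpCoeff n y`
of `HexSAWSurfaceYcGrowth.lean` is the business of part II (`HexSAWSurfaceYcLimitAllY.lean`).

Surface visits.  Along a brick-wall walk from `0` the parity of `X_i + Y_i` is that of `i` (`HexBW.parity_apply`), and under the
chart of part II the surface vertices (level `0`) are the sites `Y = 0`, `X` even; so "time `i ≥ 1` is a surface visit" is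
`i` even `∧ Y_i = 0` — `visits n ω` counts them on `[1, n]` (recursively in `n`).

## Contents (namespace `…SAW.HexBW.Wall`; everything PROVED, no `sorry`)

* objects: `hpw n` (half-plane walks `Y ≤ 0`), `archs n` (those ending with a visit: `n` even, `Y_n = 0`), `wbr n` (WALL
  BRIDGES: arches with `X_0 ≤ X_i ≤ X_n`, weak on both sides), weights `Cw`, `Aw`, `WB n y = Σ y^{visits}`;
* `mul_WB_le : y · WB n₁ y · WB n₂ y ≤ WB (n₁ + (2 + n₂)) y` — concatenation through the two-step junction
  `E → E + e₀ → E + 2e₀` (one new visit), `jcat`;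
* FEKETE: `wallSeq y k = y · WB (2k-2) y` is supermultiplicative; **`wallRate y`** `= β(y)` with
  `WB_le_pow : WB m y ≤ (β²/y) βᵐ` and `eventually_mul_pow_le_WB : r < β → ∀ᶠ j, (r²/y) r^{2j} ≤ WB (2j) y`;
* TWO-SIDED UNFOLDING WITHOUT TRANSPOSE: `revN` (time reversal composed with `X ↦ X_n − X`, `Y ↦ Y − Y_n`, a brick-wall
  automorphism for `n` even), `G = unfold ∘ revN ∘ unfold ∘ revN` keeps `Y` POINTWISE, makes `X` weakly minimal at the start and
  maximal at the end, is brick-wall preserving and at most `e^{6√n}`-to-one (two codes, `Zd.unfold_code_injOn`):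
  **`Aw_le_exp_mul_WB : Aw n y ≤ e^{6√n} · WB n y`** (fibrewise in the number of visits);
* LAST-VISIT SPLIT: **`Cw_le_sum : Cw n y ≤ Σ_{k ≤ n} Aw k y · #(saws (n-k))`** (`Zd.prefixWalk` / `Zd.suffixWalk`; the suffix
  is re-based at a site of even parity, so it is again a brick-wall walk);
* `WB_le_Cw`, `WB_le_Cw_succ` (append one `+e₀` step: `Zd.snocStep`), `WB_pos`.

Sources. J. M. Hammersley, G. M. Torrie, S. G. Whittington, *Self-avoiding walks interacting with a surface*, J. Phys. A 15
(1982) 539–571 (existence of the free energy via unfolding and concatenation of surface bridges); N. R. Beaton, M. Bousquet-Mélou,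
J. de Gier, H. Duminil-Copin, A. J. Guttmann, CMP 326 (2014), §3.1, Proposition 5 (arXiv v5 p. 9); N. Madras, G. Slade,
*The Self-Avoiding Walk* (1993), §1.2 (Lemma 1.2.2, (1.2.15)–(1.2.17)) and §3.1 (Proposition 3.1.5: unfolding, codes of
increments); E. J. Janse van Rensburg, *The Statistical Mechanics of Interacting Walks…* (2nd ed. 2015), §9.1 (positive walks,
"the unfolding of a positive walk into a doubly unfolded walk", Theorem 9.3: the limiting free energy of adsorbing walks exists).
-/

noncomputable section

open Finset Filter Function
open Literature.Probability.LatticeModels Literature.Probability.Percolation SimpleGraph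
open Literature.Combinatorics.Enumerative
open _root_.Topology

namespace Literature.Probability.RandomPlanarGeometry.SAW.HexBW.Wall

/-! ### Arithmetic helpers -/

-- `adj_add_iff_of_even` (translation by an even site is an automorphism) is the tree's `HexBW.adj_add_iff_of_even`
-- (`HexSAWBrickWallPieces.lean`), reused by name below.

/-- `z ↦ negY (c − z)` (reflect `X` in `c₀/2`, re-base `Y` at `c₁` and negate) is an automorphism of the brick wall when
`c` has even parity. [cite: EntingJensen2009, §7.4.2, Fig. 7.10 (brickwork form of the honeycomb lattice)] -/
theorem adj_negY_sub_iff {c : Site 2} (hc : (c 0 + c 1) % 2 = 0) (x y : Site 2) :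
    brickWallGraph.Adj (negY (c - x)) (negY (c - y)) ↔ brickWallGraph.Adj x y := by
  simp only [brickWallGraph_adj_coord, negY_apply_zero, negY_apply_one, Pi.sub_apply]
  omega

/-- Coordinates of the straight walk. [cite: EntingJensen2009, §7.4.2, Fig. 7.10 (brickwork form of the honeycomb lattice)] -/
theorem straightWalk_apply_zero (n i : ℕ) : Zd.straightWalk 2 n i 0 = ((min i n : ℕ) : ℤ) := by
  simp [Zd.straightWalk]

/-- Coordinates of the straight walk. [cite: EntingJensen2009, §7.4.2, Fig. 7.10 (brickwork form of the honeycomb lattice)] -/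
theorem straightWalk_apply_one (n i : ℕ) : Zd.straightWalk 2 n i 1 = 0 := by
  simp [Zd.straightWalk]

/-! ### Surface visits -/

/-- **Number of surface visits at times `1, …, n`**: times `i` with `i` even and `Y_i = 0`. [cite: BeatonBousquetMelouDeGierDuminilCopinGuttmann2014, §3.1 (arXiv v5 p. 8: "C_k^+(y) … number of contacts with the surface")] -/
def visits : ℕ → (ℕ → Site 2) → ℕ
  | 0, _ => 0
  | n + 1, ω => visits n ω + (if (n + 1) % 2 = 0 ∧ ω (n + 1) 1 = 0 then 1 else 0)

/-- `visits 0 = 0`. [cite: BeatonBousquetMelouDeGierDuminilCopinGuttmann2014, §3.1 (arXiv v5 p. 8: c(ω), the number of contacts with the surface)] -/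
@[simp] theorem visits_zero (ω : ℕ → Site 2) : visits 0 ω = 0 := rfl

/-- The recursion for `visits`. [cite: BeatonBousquetMelouDeGierDuminilCopinGuttmann2014, §3.1 (arXiv v5 p. 8: c(ω), the number of contacts with the surface)] -/
theorem visits_succ (n : ℕ) (ω : ℕ → Site 2) :
    visits (n + 1) ω = visits n ω + (if (n + 1) % 2 = 0 ∧ ω (n + 1) 1 = 0 then 1 else 0) := rfl

/-- `visits n ω ≤ n`. [cite: BeatonBousquetMelouDeGierDuminilCopinGuttmann2014, §3.1 (arXiv v5 p. 8: c(ω), the number of contacts with the surface)] -/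
theorem visits_le (n : ℕ) (ω : ℕ → Site 2) : visits n ω ≤ n := by
  induction n with
  | zero => simp
  | succ n ih => rw [visits_succ]; split_ifs <;> omega

/-- `visits n` depends only on `Y_1, …, Y_n`. [cite: BeatonBousquetMelouDeGierDuminilCopinGuttmann2014, §3.1 (arXiv v5 p. 8: c(ω), the number of contacts with the surface)] -/
theorem visits_congr {n : ℕ} {ω ξ : ℕ → Site 2} (h : ∀ i, 1 ≤ i → i ≤ n → ω i 1 = ξ i 1) :
    visits n ω = visits n ξ := by
  induction n with
  | zero => rfl
  | succ n ih =>
    rw [visits_succ, visits_succ, ih (fun i h1 hi => h i h1 (by omega)), h (n + 1) (by omega) le_rfl]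

/-- Additivity of `visits` over a cut at an EVEN time `a`. [cite: BeatonBousquetMelouDeGierDuminilCopinGuttmann2014, §3.1 (arXiv v5 p. 8: c(ω), the number of contacts with the surface)] -/
theorem visits_add {a b : ℕ} {ζ ξ : ℕ → Site 2} (ha : a % 2 = 0)
    (h : ∀ j, 1 ≤ j → j ≤ b → ζ (a + j) 1 = ξ j 1) :
    visits (a + b) ζ = visits a ζ + visits b ξ := by
  induction b with
  | zero => simp
  | succ b ih =>
    have e := h (b + 1) (by omega) le_rfl
    rw [← add_assoc] at e
    rw [← add_assoc, visits_succ, visits_succ, ih (fun j h1 hj => h j h1 (by omega)), e]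
    split_ifs <;> omega

/-- No visit after time `k`: `visits (k + b) = visits k`. [cite: BeatonBousquetMelouDeGierDuminilCopinGuttmann2014, §3.1 (arXiv v5 p. 8: c(ω), the number of contacts with the surface)] -/
theorem visits_add_eq_left {k b : ℕ} {ζ : ℕ → Site 2}
    (h : ∀ j, 1 ≤ j → j ≤ b → ¬ ((k + j) % 2 = 0 ∧ ζ (k + j) 1 = 0)) :
    visits (k + b) ζ = visits k ζ := by
  induction b with
  | zero => rfl
  | succ b ih =>
    have e := h (b + 1) (by omega) le_rfl
    rw [← add_assoc] at e
    rw [← add_assoc, visits_succ, ih (fun j h1 hj => h j h1 (by omega)), if_neg e, add_zero]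

/-! ### Half-plane walks, arches, wall bridges and their weights -/

/-- The walk stays in the half-plane `Y ≤ 0` up to time `n`. [cite: HammersleyTorrieWhittington1982, §2 (walks confined to a half-space, attached to the surface)] -/
def InHP (n : ℕ) (ω : ℕ → Site 2) : Prop := ∀ i ≤ n, ω i 1 ≤ 0

/-- The walk ends with a surface visit: `n` even and `Y_n = 0`. [cite: HammersleyTorrieWhittington1982, §2] -/
def IsArch (n : ℕ) (ω : ℕ → Site 2) : Prop := n % 2 = 0 ∧ ω n 1 = 0

/-- `X` is weakly minimal at the start and weakly maximal at the end. [cite: MadrasSlade1993, §1.2, Definition 1.2.1 (bridges)] -/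
def IsWB (n : ℕ) (ω : ℕ → Site 2) : Prop := ∀ i ≤ n, ω 0 0 ≤ ω i 0 ∧ ω i 0 ≤ ω n 0

open Classical in
/-- **Half-plane walks**: `n`-step brick-wall SAWs from `0` with `Y ≤ 0`. [cite: BeatonBousquetMelouDeGierDuminilCopinGuttmann2014, §3.1 (arXiv v5 p. 8: self-avoiding walks in a half-plane, starting on the surface)] -/
def hpw (n : ℕ) : Finset (ℕ → Site 2) := (saws n).filter (InHP n)

open Classical in
/-- **Arches** (surface returns): half-plane walks ending with a surface visit. [cite: HammersleyTorrieWhittington1982, §2] -/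
def archs (n : ℕ) : Finset (ℕ → Site 2) := (hpw n).filter (IsArch n)

open Classical in
/-- **Wall bridges**: arches with `X_0 ≤ X_i ≤ X_n` throughout. [cite: HammersleyTorrieWhittington1982, §2 (surface bridges)] -/
def wbr (n : ℕ) : Finset (ℕ → Site 2) := (archs n).filter (IsWB n)

variable {n : ℕ} {ω : ℕ → Site 2} {y : ℝ}

/-- Membership in `hpw`. [cite: HammersleyTorrieWhittington1982, §2 (surface bridges); BeatonBousquetMelouDeGierDuminilCopinGuttmann2014, §3.1, Proposition 5 (arXiv v5 p. 9)] -/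
theorem mem_hpw : ω ∈ hpw n ↔ ω ∈ saws n ∧ InHP n ω := by
  classical
  exact Finset.mem_filter

/-- Membership in `archs`. [cite: HammersleyTorrieWhittington1982, §2 (surface bridges); BeatonBousquetMelouDeGierDuminilCopinGuttmann2014, §3.1, Proposition 5 (arXiv v5 p. 9)] -/
theorem mem_archs : ω ∈ archs n ↔ ω ∈ hpw n ∧ IsArch n ω := by
  classical
  exact Finset.mem_filter

/-- Membership in `wbr`. [cite: HammersleyTorrieWhittington1982, §2 (surface bridges); BeatonBousquetMelouDeGierDuminilCopinGuttmann2014, §3.1, Proposition 5 (arXiv v5 p. 9)] -/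
theorem mem_wbr : ω ∈ wbr n ↔ ω ∈ archs n ∧ IsWB n ω := by
  classical
  exact Finset.mem_filter

/-- `hpw n ⊆ saws n`. [cite: HammersleyTorrieWhittington1982, §2 (surface bridges); BeatonBousquetMelouDeGierDuminilCopinGuttmann2014, §3.1, Proposition 5 (arXiv v5 p. 9)] -/
theorem hpw_subset : hpw n ⊆ saws n := fun _ h => (mem_hpw.1 h).1

/-- `archs n ⊆ hpw n`. [cite: HammersleyTorrieWhittington1982, §2 (surface bridges); BeatonBousquetMelouDeGierDuminilCopinGuttmann2014, §3.1, Proposition 5 (arXiv v5 p. 9)] -/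
theorem archs_subset : archs n ⊆ hpw n := fun _ h => (mem_archs.1 h).1

/-- `wbr n ⊆ archs n`. [cite: HammersleyTorrieWhittington1982, §2 (surface bridges); BeatonBousquetMelouDeGierDuminilCopinGuttmann2014, §3.1, Proposition 5 (arXiv v5 p. 9)] -/
theorem wbr_subset : wbr n ⊆ archs n := fun _ h => (mem_wbr.1 h).1

/-- **`C^w_n(y) = Σ_{half-plane walks} y^{visits}`**. [cite: BeatonBousquetMelouDeGierDuminilCopinGuttmann2014, §3.1 (arXiv v5 p. 8: C_k^+(y))] -/
def Cw (n : ℕ) (y : ℝ) : ℝ := ∑ ω ∈ hpw n, y ^ visits n ω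

/-- **`A_n(y) = Σ_{arches} y^{visits}`**. [cite: HammersleyTorrieWhittington1982, §2] -/
def Aw (n : ℕ) (y : ℝ) : ℝ := ∑ ω ∈ archs n, y ^ visits n ω

/-- **`B^w_n(y) = Σ_{wall bridges} y^{visits}`**. [cite: HammersleyTorrieWhittington1982, §2 (surface bridges)] -/
def WB (n : ℕ) (y : ℝ) : ℝ := ∑ ω ∈ wbr n, y ^ visits n ω

/-- `0 ≤ C^w_n(y)`. [cite: HammersleyTorrieWhittington1982, §2 (surface bridges); BeatonBousquetMelouDeGierDuminilCopinGuttmann2014, §3.1, Proposition 5 (arXiv v5 p. 9)] -/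
theorem Cw_nonneg (n : ℕ) (hy : 0 ≤ y) : 0 ≤ Cw n y := Finset.sum_nonneg fun _ _ => pow_nonneg hy _

/-- `0 ≤ A_n(y)`. [cite: HammersleyTorrieWhittington1982, §2 (surface bridges); BeatonBousquetMelouDeGierDuminilCopinGuttmann2014, §3.1, Proposition 5 (arXiv v5 p. 9)] -/
theorem Aw_nonneg (n : ℕ) (hy : 0 ≤ y) : 0 ≤ Aw n y := Finset.sum_nonneg fun _ _ => pow_nonneg hy _

/-- `0 ≤ B^w_n(y)`. [cite: HammersleyTorrieWhittington1982, §2 (surface bridges); BeatonBousquetMelouDeGierDuminilCopinGuttmann2014, §3.1, Proposition 5 (arXiv v5 p. 9)] -/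
theorem WB_nonneg (n : ℕ) (hy : 0 ≤ y) : 0 ≤ WB n y := Finset.sum_nonneg fun _ _ => pow_nonneg hy _

/-- `B^w_n ≤ A_n`. [cite: HammersleyTorrieWhittington1982, §2 (surface bridges); BeatonBousquetMelouDeGierDuminilCopinGuttmann2014, §3.1, Proposition 5 (arXiv v5 p. 9)] -/
theorem WB_le_Aw (n : ℕ) (hy : 0 ≤ y) : WB n y ≤ Aw n y :=
  Finset.sum_le_sum_of_subset_of_nonneg wbr_subset fun _ _ _ => pow_nonneg hy _

/-- `A_n ≤ C^w_n`. [cite: HammersleyTorrieWhittington1982, §2 (surface bridges); BeatonBousquetMelouDeGierDuminilCopinGuttmann2014, §3.1, Proposition 5 (arXiv v5 p. 9)] -/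
theorem Aw_le_Cw (n : ℕ) (hy : 0 ≤ y) : Aw n y ≤ Cw n y :=
  Finset.sum_le_sum_of_subset_of_nonneg archs_subset fun _ _ _ => pow_nonneg hy _

/-- `B^w_n ≤ C^w_n`. [cite: HammersleyTorrieWhittington1982, §2 (surface bridges); BeatonBousquetMelouDeGierDuminilCopinGuttmann2014, §3.1, Proposition 5 (arXiv v5 p. 9)] -/
theorem WB_le_Cw (n : ℕ) (hy : 0 ≤ y) : WB n y ≤ Cw n y := (WB_le_Aw n hy).trans (Aw_le_Cw n hy)

/-- If `n` is odd there are no arches. [cite: HammersleyTorrieWhittington1982, §2 (surface bridges); BeatonBousquetMelouDeGierDuminilCopinGuttmann2014, §3.1, Proposition 5 (arXiv v5 p. 9)] -/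
theorem archs_eq_empty_of_odd (hn : n % 2 = 1) : archs n = ∅ := by
  refine Finset.eq_empty_of_forall_notMem fun ω hω => ?_
  have h := (mem_archs.1 hω).2.1
  omega

/-- If `n` is odd, `A_n = 0`. [cite: HammersleyTorrieWhittington1982, §2 (surface bridges); BeatonBousquetMelouDeGierDuminilCopinGuttmann2014, §3.1, Proposition 5 (arXiv v5 p. 9)] -/
theorem Aw_eq_zero_of_odd (hn : n % 2 = 1) (y : ℝ) : Aw n y = 0 := by
  rw [Aw, archs_eq_empty_of_odd hn, Finset.sum_empty]

/-- If `n` is odd there are no wall bridges. [cite: HammersleyTorrieWhittington1982, §2 (surface bridges); BeatonBousquetMelouDeGierDuminilCopinGuttmann2014, §3.1, Proposition 5 (arXiv v5 p. 9)] -/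
theorem wbr_eq_empty_of_odd (hn : n % 2 = 1) : wbr n = ∅ := by
  refine Finset.eq_empty_of_forall_notMem fun ω hω => ?_
  have h := (mem_archs.1 (wbr_subset hω)).2.1
  omega

/-- If `n` is odd, `B^w_n = 0`. [cite: HammersleyTorrieWhittington1982, §2 (surface bridges); BeatonBousquetMelouDeGierDuminilCopinGuttmann2014, §3.1, Proposition 5 (arXiv v5 p. 9)] -/
theorem WB_eq_zero_of_odd (hn : n % 2 = 1) (y : ℝ) : WB n y = 0 := by
  rw [WB, wbr_eq_empty_of_odd hn, Finset.sum_empty]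

/-- The straight walk along the surface is a wall bridge. [cite: BeatonBousquetMelouDeGierDuminilCopinGuttmann2014, §3.1 (arXiv v5 p. 9: walks sticking to the surface)] -/
theorem straightWalk_mem_wbr (j : ℕ) : Zd.straightWalk 2 (2 * j) ∈ wbr (2 * j) := by
  rw [mem_wbr, mem_archs, mem_hpw]
  refine ⟨⟨⟨straightWalk_mem (2 * j), fun i _ => by rw [straightWalk_apply_one]⟩,
    ⟨by omega, straightWalk_apply_one _ _⟩⟩, fun i hi => ?_⟩
  simp only [straightWalk_apply_zero]
  constructor <;> push_cast <;> omega

/-- `B^w_{2j}(y) > 0` for `y > 0`. [cite: HammersleyTorrieWhittington1982, §2 (surface bridges); BeatonBousquetMelouDeGierDuminilCopinGuttmann2014, §3.1, Proposition 5 (arXiv v5 p. 9)] -/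
theorem WB_pos (hy : 0 < y) (j : ℕ) : 0 < WB (2 * j) y := by
  rw [WB]
  exact lt_of_lt_of_le (pow_pos hy _)
    (Finset.single_le_sum (fun _ _ => pow_nonneg hy.le _) (straightWalk_mem_wbr j))

/-! ### Brick-wall bookkeeping for concatenation -/

/-- A concatenation of brick-wall walks glued at a site of even parity is a brick-wall walk. [cite: MadrasSlade1993, §1.2, (1.2.15)] -/
theorem isBW_concatWalk {m k : ℕ} {ω υ : ℕ → Site 2} (hω : IsBW m ω) (hυ : IsBW k υ) (hυ0 : υ 0 = 0)
    (hpar : (ω m 0 + ω m 1) % 2 = 0) : IsBW (m + k) (Zd.concatWalk m ω υ) := by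
  intro i hi
  rcases Nat.lt_or_ge i m with him | him
  · rw [Zd.concatWalk_apply_of_le ω υ him.le, Zd.concatWalk_apply_of_le ω υ (by omega)]
    exact hω i him
  · obtain ⟨j, rfl⟩ : ∃ j, i = m + j := ⟨i - m, by omega⟩
    rw [Zd.concatWalk_apply_add ω υ hυ0 j, show m + j + 1 = m + (j + 1) by omega,
      Zd.concatWalk_apply_add ω υ hυ0 (j + 1), add_comm (ω m) (υ j), add_comm (ω m) (υ (j + 1))]
    exact (adj_add_iff_of_even hpar _ _).2 (hυ j (by omega))

/-! ### Concatenation of wall bridges through a two-step junction: `y B^w_{n₁} B^w_{n₂} ≤ B^w_{n₁+2+n₂}` -/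

/-- The tail piece: the junction `0 → e₀ → 2e₀` followed by (the translate of) `υ`. [cite: HammersleyTorrieWhittington1982, §2 (concatenation of surface bridges)] -/
def tailPiece (υ : ℕ → Site 2) : ℕ → Site 2 := Zd.concatWalk 2 (Zd.straightWalk 2 2) υ

/-- **Junction concatenation** of two wall bridges: `ω`, then `E → E + e₀ → E + 2e₀`, then `υ` translated to `E + 2e₀`.
[cite: HammersleyTorrieWhittington1982, §2 (concatenation of surface bridges)] -/
def jcat (n₁ : ℕ) (ω υ : ℕ → Site 2) : ℕ → Site 2 := Zd.concatWalk n₁ ω (tailPiece υ)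

/-- Values of the tail piece on the junction. [cite: EntingJensen2009, §7.4.2, Fig. 7.10 (brickwork form of the honeycomb lattice)] -/
theorem tailPiece_apply_of_le (υ : ℕ → Site 2) {i : ℕ} (hi : i ≤ 2) :
    tailPiece υ i = Zd.straightWalk 2 2 i := Zd.concatWalk_apply_of_le _ _ hi

/-- Values of the tail piece after the junction. [cite: EntingJensen2009, §7.4.2, Fig. 7.10 (brickwork form of the honeycomb lattice)] -/
theorem tailPiece_apply_add {υ : ℕ → Site 2} (h0 : υ 0 = 0) (j : ℕ) :
    tailPiece υ (2 + j) = Zd.straightWalk 2 2 2 + υ j := Zd.concatWalk_apply_add _ _ h0 j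

/-- First coordinate of the tail piece: on the junction it is `i`. [cite: EntingJensen2009, §7.4.2, Fig. 7.10 (brickwork form of the honeycomb lattice)] -/
theorem tailPiece_apply_zero_of_le (υ : ℕ → Site 2) {i : ℕ} (hi : i ≤ 2) : tailPiece υ i 0 = i := by
  rw [tailPiece_apply_of_le υ hi, straightWalk_apply_zero, min_eq_left hi]

/-- Second coordinate of the tail piece: on the junction it is `0`. [cite: EntingJensen2009, §7.4.2, Fig. 7.10 (brickwork form of the honeycomb lattice)] -/
theorem tailPiece_apply_one_of_le (υ : ℕ → Site 2) {i : ℕ} (hi : i ≤ 2) : tailPiece υ i 1 = 0 := by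
  rw [tailPiece_apply_of_le υ hi, straightWalk_apply_one]

/-- First coordinate of the tail piece after the junction: `2 + X^υ_j`. [cite: EntingJensen2009, §7.4.2, Fig. 7.10 (brickwork form of the honeycomb lattice)] -/
theorem tailPiece_apply_add_zero {υ : ℕ → Site 2} (h0 : υ 0 = 0) (j : ℕ) : tailPiece υ (2 + j) 0 = 2 + υ j 0 := by
  rw [tailPiece_apply_add h0, Pi.add_apply, straightWalk_apply_zero]; simp

/-- Second coordinate of the tail piece after the junction: `Y^υ_j`. [cite: EntingJensen2009, §7.4.2, Fig. 7.10 (brickwork form of the honeycomb lattice)] -/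
theorem tailPiece_apply_add_one {υ : ℕ → Site 2} (h0 : υ 0 = 0) (j : ℕ) : tailPiece υ (2 + j) 1 = υ j 1 := by
  rw [tailPiece_apply_add h0, Pi.add_apply, straightWalk_apply_one, zero_add]

/-- A straight run of length `k` followed by a walk, as a `ℤ²` SAW (variable `k`: closed `Zd.saws 2 2` terms must never meet
the unifier — they get evaluated). [cite: MadrasSlade1993, §1.2, (1.2.15)] -/
theorem straight_concat_mem_zd (k : ℕ) {n₂ : ℕ} {υ : ℕ → Site 2} (hu : υ ∈ Zd.saws 2 n₂)
    (hsep : ∀ i ≤ k, ∀ j, 1 ≤ j → j ≤ n₂ → Zd.straightWalk 2 k i ≠ Zd.straightWalk 2 k k + υ j) :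
    Zd.concatWalk k (Zd.straightWalk 2 k) υ ∈ Zd.saws 2 (k + n₂) :=
  Zd.concatWalk_mem_saws (Zd.straightWalk_mem_saws 2 k) hu hsep

/-- The straight walk is a brick-wall walk. [cite: EntingJensen2009, §7.4.2, Fig. 7.10 (brickwork form of the honeycomb lattice)] -/
theorem isBW_straight (k : ℕ) : IsBW k (Zd.straightWalk 2 k) := (mem_saws.1 (straightWalk_mem k)).2

/-- The tail piece determines `υ` (for walks from `0`). [cite: EntingJensen2009, §7.4.2, Fig. 7.10 (brickwork form of the honeycomb lattice)] -/
theorem tailPiece_injective {υ υ' : ℕ → Site 2} (h0 : υ 0 = 0) (h0' : υ' 0 = 0)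
    (h : tailPiece υ = tailPiece υ') : υ = υ' := by
  funext j
  have e := congrFun h (2 + j)
  rw [tailPiece_apply_add h0, tailPiece_apply_add h0'] at e
  exact add_left_cancel e

/-- The tail piece of a wall bridge: a brick-wall SAW with `Y ≤ 0`, `1 ≤ X_i` for `i ≥ 1`, `0 ≤ X_i ≤ X_end`, ending on `Y = 0`,
with `visits = visits υ + 1`. [cite: HammersleyTorrieWhittington1982, §2 (concatenation of surface bridges)] -/
theorem tailPiece_spec {n₂ : ℕ} {υ : ℕ → Site 2} (hυ : υ ∈ wbr n₂) :
    tailPiece υ ∈ saws (2 + n₂) ∧ (∀ i ≤ 2 + n₂, tailPiece υ i 1 ≤ 0) ∧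
      (∀ i, 1 ≤ i → i ≤ 2 + n₂ → 1 ≤ tailPiece υ i 0) ∧ (∀ i ≤ 2 + n₂, 0 ≤ tailPiece υ i 0 ∧
        tailPiece υ i 0 ≤ tailPiece υ (2 + n₂) 0) ∧ tailPiece υ (2 + n₂) 1 = 0 ∧
      visits (2 + n₂) (tailPiece υ) = visits n₂ υ + 1 := by
  obtain ⟨hυa, hwb⟩ := mem_wbr.1 hυ
  obtain ⟨hυh, hn₂, hend0⟩ := mem_archs.1 hυa
  obtain ⟨hυs, hhp⟩ := mem_hpw.1 hυh
  obtain ⟨h0, -, hbw, hinj⟩ := mem_saws_iff.1 hυs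
  have hX0 : υ 0 0 = 0 := by rw [h0]; rfl
  have hXnn : ∀ j ≤ n₂, 0 ≤ υ j 0 ∧ υ j 0 ≤ υ n₂ 0 := fun j hj => by
    have := hwb j hj; rw [hX0] at this; exact this
  -- values
  have hv : ∀ i ≤ 2 + n₂, (i ≤ 2 ∧ tailPiece υ i 0 = i ∧ tailPiece υ i 1 = 0) ∨
      (∃ j ≤ n₂, i = 2 + j ∧ tailPiece υ i 0 = 2 + υ j 0 ∧ tailPiece υ i 1 = υ j 1) := by
    intro i hi
    rcases le_or_gt i 2 with h2 | h2
    · exact Or.inl ⟨h2, tailPiece_apply_zero_of_le υ h2, tailPiece_apply_one_of_le υ h2⟩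
    · refine Or.inr ⟨i - 2, by omega, by omega, ?_, ?_⟩
      · rw [show i = 2 + (i - 2) by omega, tailPiece_apply_add_zero h0]; simp
      · rw [show i = 2 + (i - 2) by omega, tailPiece_apply_add_one h0]; simp
  refine ⟨?_, ?_, ?_, ?_, ?_, ?_⟩
  · -- SAW and brick-wall
    have hsep : ∀ i ≤ 2, ∀ j, 1 ≤ j → j ≤ n₂ → Zd.straightWalk 2 2 i ≠ Zd.straightWalk 2 2 2 + υ j := by
      intro i hi j hj1 hj e
      have e0 := congrFun e 0
      rw [Pi.add_apply, straightWalk_apply_zero, straightWalk_apply_zero, min_eq_left hi, min_self] at e0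
      have hj0 := (hXnn j hj).1
      have hi2 : i = 2 := by push_cast at e0; omega
      subst hi2
      have hυj : υ j = 0 := by
        have : Zd.straightWalk 2 2 2 + υ j = Zd.straightWalk 2 2 2 + 0 := by rw [add_zero]; exact e.symm
        exact add_left_cancel this
      have := hinj (show j ∈ {i | i ≤ n₂} from hj) (show 0 ∈ {i | i ≤ n₂} from Nat.zero_le _) (by rw [hυj, h0])
      omega
    have hzd : tailPiece υ ∈ Zd.saws 2 (2 + n₂) := straight_concat_mem_zd 2 (saws_subset _ hυs) hsep
    refine mem_saws.2 ⟨hzd, isBW_concatWalk (isBW_straight 2) hbw h0 ?_⟩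
    rw [straightWalk_apply_zero, straightWalk_apply_one]; simp
  · intro i hi
    rcases hv i hi with ⟨-, -, h1⟩ | ⟨j, hj, -, -, h1⟩
    · rw [h1]
    · rw [h1]; exact hhp j hj
  · intro i hi1 hi
    rcases hv i hi with ⟨-, h0', -⟩ | ⟨j, hj, -, h0', -⟩
    · rw [h0']; exact_mod_cast hi1
    · rw [h0']; linarith [(hXnn j hj).1]
  · have hlast : tailPiece υ (2 + n₂) 0 = 2 + υ n₂ 0 := tailPiece_apply_add_zero h0 n₂
    intro i hi
    rcases hv i hi with ⟨h2, h0', -⟩ | ⟨j, hj, -, h0', -⟩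
    · rw [h0', hlast]
      constructor
      · exact_mod_cast Nat.zero_le i
      · have : (i : ℤ) ≤ 2 := by exact_mod_cast h2
        linarith [(hXnn n₂ le_rfl).1]
    · rw [h0', hlast]
      constructor
      · linarith [(hXnn j hj).1]
      · linarith [(hXnn j hj).2]
  · rw [tailPiece_apply_add_one h0]; exact hend0
  · rw [visits_add (a := 2) (b := n₂) (ξ := υ) (by decide) fun j _ _ => tailPiece_apply_add_one h0 j]
    have h2 : visits 2 (tailPiece υ) = 1 := by
      rw [show (2 : ℕ) = 0 + 1 + 1 from rfl, visits_succ, visits_succ, visits_zero]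
      have h21 : tailPiece υ (0 + 1 + 1) 1 = 0 := tailPiece_apply_one_of_le υ le_rfl
      simp [h21]
    rw [h2]; ring

/-- **The junction concatenation of two wall bridges is a wall bridge with `visits = v₁ + v₂ + 1`.**
[cite: HammersleyTorrieWhittington1982, §2 (concatenation of surface bridges)] -/
theorem jcat_spec {n₁ n₂ : ℕ} {ω υ : ℕ → Site 2} (hω : ω ∈ wbr n₁) (hυ : υ ∈ wbr n₂) :
    jcat n₁ ω υ ∈ wbr (n₁ + (2 + n₂)) ∧
      visits (n₁ + (2 + n₂)) (jcat n₁ ω υ) = visits n₁ ω + visits n₂ υ + 1 := by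
  obtain ⟨hT, hTY, hTX1, hTX, hTend, hTv⟩ := tailPiece_spec hυ
  have hn₂ : n₂ % 2 = 0 := (mem_archs.1 (wbr_subset hυ)).2.1
  obtain ⟨hωa, hwb⟩ := mem_wbr.1 hω
  obtain ⟨hωh, hn₁, hend0⟩ := mem_archs.1 hωa
  obtain ⟨hωs, hhp⟩ := mem_hpw.1 hωh
  obtain ⟨h0, -, hbw, -⟩ := mem_saws_iff.1 hωs
  obtain ⟨hT0, -, hTbw, -⟩ := mem_saws_iff.1 hT
  have hpar : (ω n₁ 0 + ω n₁ 1) % 2 = 0 := by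
    have := parity_apply hωs le_rfl; rw [hend0] at this ⊢; omega
  -- values of jcat
  have hv1 : ∀ i ≤ n₁, jcat n₁ ω υ i = ω i := fun i hi => Zd.concatWalk_apply_of_le _ _ hi
  have hv2 : ∀ j, jcat n₁ ω υ (n₁ + j) = ω n₁ + tailPiece υ j := fun j => Zd.concatWalk_apply_add _ _ hT0 j
  have hmem : jcat n₁ ω υ ∈ saws (n₁ + (2 + n₂)) := by
    refine mem_saws.2 ⟨Zd.concatWalk_mem_saws (saws_subset _ hωs) (saws_subset _ hT) ?_, isBW_concatWalk hbw hTbw hT0 hpar⟩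
    intro i hi j hj1 hj e
    have e0 := congrFun e 0
    rw [Pi.add_apply] at e0
    have := (hwb i hi).2
    have := hTX1 j hj1 hj
    omega
  refine ⟨mem_wbr.2 ⟨mem_archs.2 ⟨mem_hpw.2 ⟨hmem, fun i hi => ?_⟩, ⟨by omega, ?_⟩⟩, fun i hi => ?_⟩, ?_⟩
  · rcases le_or_gt i n₁ with h | h
    · rw [hv1 i h]; exact hhp i h
    · rw [show i = n₁ + (i - n₁) by omega, hv2, Pi.add_apply, hend0, zero_add]
      exact hTY _ (by omega)
  · rw [hv2, Pi.add_apply, hend0, hTend, add_zero]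
  · have hlast : jcat n₁ ω υ (n₁ + (2 + n₂)) 0 = ω n₁ 0 + tailPiece υ (2 + n₂) 0 := by rw [hv2, Pi.add_apply]
    have hfirst : jcat n₁ ω υ 0 0 = ω 0 0 := by rw [hv1 0 (Nat.zero_le _)]
    rw [hlast, hfirst]
    rcases le_or_gt i n₁ with h | h
    · rw [hv1 i h]
      have := hwb i h
      have := (hTX (2 + n₂) le_rfl).1
      constructor <;> linarith
    · rw [show i = n₁ + (i - n₁) by omega, hv2, Pi.add_apply]
      have := hTX (i - n₁) (by omega)
      have := hwb n₁ le_rfl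
      constructor <;> linarith
  · rw [visits_add (a := n₁) (b := 2 + n₂) (ξ := tailPiece υ) hn₁ fun j _ _ => by
      rw [hv2, Pi.add_apply, hend0, zero_add], hTv, visits_congr (ξ := ω) fun i _ hi => by rw [hv1 i hi]]
    ring

/-- **`y · B^w_{n₁}(y) · B^w_{n₂}(y) ≤ B^w_{n₁+2+n₂}(y)`** (junction concatenation is injective and adds one visit).
[cite: HammersleyTorrieWhittington1982, §2 (supermultiplicativity of surface bridges); MadrasSlade1993, §1.2, (1.2.15)] -/
theorem mul_WB_le (n₁ n₂ : ℕ) (hy : 0 ≤ y) : y * WB n₁ y * WB n₂ y ≤ WB (n₁ + (2 + n₂)) y := by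
  classical
  have hinj : Set.InjOn (fun p : (ℕ → Site 2) × (ℕ → Site 2) => jcat n₁ p.1 p.2) ↑(wbr n₁ ×ˢ wbr n₂) := by
    rintro ⟨ω, υ⟩ hp ⟨ω', υ'⟩ hp' h
    rw [Finset.mem_coe, Finset.mem_product] at hp hp'
    dsimp only at h
    have hωs := hpw_subset (archs_subset (wbr_subset hp.1))
    have hω's := hpw_subset (archs_subset (wbr_subset hp'.1))
    have hυs := hpw_subset (archs_subset (wbr_subset hp.2))
    have hυ's := hpw_subset (archs_subset (wbr_subset hp'.2))
    obtain ⟨h1, h2⟩ := Zd.concatWalk_injective_pieces (saws_subset _ hωs) (saws_subset _ (tailPiece_spec hp.2).1)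
      (saws_subset _ hω's) (saws_subset _ (tailPiece_spec hp'.2).1) h
    have h3 := tailPiece_injective (mem_saws_iff.1 hυs).1 (mem_saws_iff.1 hυ's).1 h2
    simp only [Prod.mk.injEq]
    exact ⟨h1, h3⟩
  calc y * WB n₁ y * WB n₂ y
      = ∑ ω ∈ wbr n₁, ∑ υ ∈ wbr n₂, y * y ^ visits n₁ ω * y ^ visits n₂ υ := by
        simp only [WB, Finset.mul_sum, Finset.sum_mul]
        exact Finset.sum_comm
    _ = ∑ ω ∈ wbr n₁, ∑ υ ∈ wbr n₂, y ^ (visits n₁ ω + visits n₂ υ + 1) := by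
        refine Finset.sum_congr rfl fun ω _ => Finset.sum_congr rfl fun υ _ => ?_
        ring
    _ = ∑ p ∈ wbr n₁ ×ˢ wbr n₂, y ^ visits (n₁ + (2 + n₂)) (jcat n₁ p.1 p.2) := by
        rw [Finset.sum_product]
        refine Finset.sum_congr rfl fun ω hω => Finset.sum_congr rfl fun υ hυ => ?_
        dsimp only
        rw [(jcat_spec hω hυ).2]
    _ = ∑ ζ ∈ (wbr n₁ ×ˢ wbr n₂).image (fun p => jcat n₁ p.1 p.2), y ^ visits (n₁ + (2 + n₂)) ζ :=
        (Finset.sum_image (f := fun ζ => y ^ visits (n₁ + (2 + n₂)) ζ) hinj).symm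
    _ ≤ WB (n₁ + (2 + n₂)) y := by
        refine Finset.sum_le_sum_of_subset_of_nonneg (fun ζ hζ => ?_) fun _ _ _ => pow_nonneg hy _
        obtain ⟨p, hp, rfl⟩ := Finset.mem_image.1 hζ
        rw [Finset.mem_product] at hp
        exact (jcat_spec hp.1 hp.2).1

/-! ### Fekete: the wall-bridge growth rate `β(y)` -/

/-- The shifted sequence `d_k = y B^w_{2k-2}(y)` (`d_0 = 1`), supermultiplicative by `mul_WB_le`.
[cite: MadrasSlade1993, §1.2, Lemma 1.2.2 and (1.2.16)] -/
def wallSeq (y : ℝ) (k : ℕ) : ℝ := if k = 0 then 1 else y * WB (2 * k - 2) y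

/-- `d_k > 0`. [cite: MadrasSlade1993, §1.2, Lemma 1.2.2] -/
theorem wallSeq_pos (hy : 0 < y) (k : ℕ) : 0 < wallSeq y k := by
  unfold wallSeq
  split_ifs with hk
  · exact one_pos
  · rw [show 2 * k - 2 = 2 * (k - 1) by omega]
    exact mul_pos hy (WB_pos hy _)

/-- **`d_p d_q ≤ d_{p+q}`**. [cite: MadrasSlade1993, §1.2, (1.2.15)–(1.2.16); HammersleyTorrieWhittington1982, §2] -/
theorem wallSeq_mul_le (hy : 0 < y) (p q : ℕ) : wallSeq y p * wallSeq y q ≤ wallSeq y (p + q) := by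
  unfold wallSeq
  rcases Nat.eq_zero_or_pos p with rfl | hp
  · simp
  rcases Nat.eq_zero_or_pos q with rfl | hq
  · simp
  rw [if_neg hp.ne', if_neg hq.ne', if_neg (by omega : p + q ≠ 0)]
  have h := mul_WB_le (2 * p - 2) (2 * q - 2) hy.le
  rw [show 2 * p - 2 + (2 + (2 * q - 2)) = 2 * (p + q) - 2 by omega] at h
  calc y * WB (2 * p - 2) y * (y * WB (2 * q - 2) y) = y * (y * WB (2 * p - 2) y * WB (2 * q - 2) y) := by ring
    _ ≤ y * WB (2 * (p + q) - 2) y := mul_le_mul_of_nonneg_left h hy.le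

/-- A priori bound: `B^w_m(y) ≤ #(saws m) · max(1,y)^m`. [cite: HammersleyTorrieWhittington1982, §2 (surface bridges); BeatonBousquetMelouDeGierDuminilCopinGuttmann2014, §3.1, Proposition 5 (arXiv v5 p. 9)] -/
theorem WB_le_card_mul_pow (m : ℕ) (hy : 0 ≤ y) : WB m y ≤ #(saws m) * max 1 y ^ m := by
  calc WB m y ≤ ∑ ω ∈ wbr m, max 1 y ^ m := Finset.sum_le_sum fun ω _ => by
        calc y ^ visits m ω ≤ max 1 y ^ visits m ω := pow_le_pow_left₀ hy (le_max_right _ _) _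
          _ ≤ max 1 y ^ m := pow_le_pow_right₀ (le_max_left _ _) (visits_le m ω)
    _ = #(wbr m) * max 1 y ^ m := by rw [Finset.sum_const, nsmul_eq_mul]
    _ ≤ #(saws m) * max 1 y ^ m := by
        gcongr
        exact (wbr_subset.trans archs_subset).trans hpw_subset

/-! ### Appending a step: `B^w_n ≤ C^w_{n+1}` -/

/-- Appending one `+e₀` step to a wall bridge gives a half-plane walk with the same visits. [cite: MadrasSlade1993, §1.2 (p. 11)] -/
theorem snocStep_mem_hpw (hω : ω ∈ wbr n) :
    Zd.snocStep n ω ∈ hpw (n + 1) ∧ visits (n + 1) (Zd.snocStep n ω) = visits n ω := by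
  obtain ⟨hωa, hwb⟩ := mem_wbr.1 hω
  obtain ⟨hωh, hn, hend0⟩ := mem_archs.1 hωa
  obtain ⟨hωs, hhp⟩ := mem_hpw.1 hωh
  obtain ⟨h0, -, hbw, -⟩ := mem_saws_iff.1 hωs
  have hzd : Zd.snocStep n ω ∈ Zd.saws 2 (n + 1) :=
    Zd.snocStep_mem_saws (saws_subset _ hωs) fun i hi => (hwb i hi).2
  have hBW : IsBW (n + 1) (Zd.snocStep n ω) := by
    intro i hi
    rcases Nat.lt_or_ge i n with hin | hin
    · rw [Zd.snocStep_of_le ω hin.le, Zd.snocStep_of_le ω (by omega)]; exact hbw i hin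
    · obtain rfl : i = n := by omega
      rw [Zd.snocStep_of_le ω le_rfl, Zd.snocStep_of_lt ω (Nat.lt_succ_self _)]
      exact adj_add_single _
  refine ⟨mem_hpw.2 ⟨mem_saws.2 ⟨hzd, hBW⟩, fun i hi => ?_⟩, ?_⟩
  · rcases Nat.lt_or_ge i (n + 1) with h | h
    · rw [Zd.snocStep_of_le ω (by omega)]; exact hhp i (by omega)
    · obtain rfl : i = n + 1 := by omega
      rw [Zd.snocStep_succ_apply_one, hend0]
  · rw [visits_succ, visits_congr (n := n) (ξ := ω) fun i _ hi => by rw [Zd.snocStep_of_le ω hi]]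
    have : ¬ ((n + 1) % 2 = 0 ∧ Zd.snocStep n ω (n + 1) 1 = 0) := fun h => by omega
    rw [if_neg this, add_zero]

/-- **`B^w_n(y) ≤ C^w_{n+1}(y)`**. [cite: MadrasSlade1993, §1.2 (p. 11)] -/
theorem WB_le_Cw_succ (n : ℕ) (hy : 0 ≤ y) : WB n y ≤ Cw (n + 1) y := by
  classical
  have hinj : Set.InjOn (Zd.snocStep n) ↑(wbr n) := by
    intro ω hω ω' hω' h
    have hωs := hpw_subset (archs_subset (wbr_subset hω))
    have hω's := hpw_subset (archs_subset (wbr_subset hω'))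
    obtain ⟨-, hend, -, -⟩ := mem_saws_iff.1 hωs
    obtain ⟨-, hend', -, -⟩ := mem_saws_iff.1 hω's
    funext i
    rcases le_or_gt i n with hi | hi
    · have := congrFun h i
      rwa [Zd.snocStep_of_le ω hi, Zd.snocStep_of_le ω' hi] at this
    · have := congrFun h n
      rw [Zd.snocStep_of_le ω le_rfl, Zd.snocStep_of_le ω' le_rfl] at this
      rw [hend i hi.le, hend' i hi.le, this]
  calc WB n y = ∑ ω ∈ wbr n, y ^ visits (n + 1) (Zd.snocStep n ω) :=
        Finset.sum_congr rfl fun ω hω => by rw [(snocStep_mem_hpw hω).2]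
    _ = ∑ ζ ∈ (wbr n).image (Zd.snocStep n), y ^ visits (n + 1) ζ :=
        (Finset.sum_image (f := fun ζ => y ^ visits (n + 1) ζ) hinj).symm
    _ ≤ Cw (n + 1) y := by
        refine Finset.sum_le_sum_of_subset_of_nonneg (fun ζ hζ => ?_) fun _ _ _ => pow_nonneg hy _
        obtain ⟨ω, hω, rfl⟩ := Finset.mem_image.1 hζ
        exact (snocStep_mem_hpw hω).1

/-! ### Time reversal adapted to the brick wall, and the transpose-free two-sided unfolding `G` -/

/-- **`revN`**: time reversal re-based at `0` (`Zd.reverseWalk`) followed by `Y ↦ -Y`; i.e. `X_i ↦ X_n − X_{n−i}`,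
`Y_i ↦ Y_{n−i} − Y_n`.  For `n` even it is a brick-wall automorphism applied to the reversed walk.
[cite: MadrasSlade1993, §3.1 (proof of Theorem 3.1.1: unfolding the reversed walk)] -/
def revN (n : ℕ) (ω : ℕ → Site 2) : ℕ → Site 2 := fun i => negY (Zd.reverseWalk n ω i)

/-- First coordinate of `revN`. [cite: EntingJensen2009, §7.4.2, Fig. 7.10 (brickwork form of the honeycomb lattice)] -/
theorem revN_apply_zero (n : ℕ) (ω : ℕ → Site 2) (i : ℕ) : revN n ω i 0 = ω n 0 - ω (n - i) 0 := by
  simp [revN, Zd.reverseWalk_apply]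

/-- Second coordinate of `revN`. [cite: EntingJensen2009, §7.4.2, Fig. 7.10 (brickwork form of the honeycomb lattice)] -/
theorem revN_apply_one (n : ℕ) (ω : ℕ → Site 2) (i : ℕ) : revN n ω i 1 = ω (n - i) 1 - ω n 1 := by
  simp [revN, Zd.reverseWalk_apply]

/-- `revN` maps `saws n` to itself when `n` is even. [cite: MadrasSlade1993, §3.1 (proof of Theorem 3.1.1)] -/
theorem revN_mem (hω : ω ∈ saws n) (hn : n % 2 = 0) : revN n ω ∈ saws n := by
  obtain ⟨h0, hend, hbw, hinj⟩ := mem_saws_iff.1 hω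
  have hpar : (ω n 0 + ω n 1) % 2 = 0 := by have := parity_apply hω le_rfl; omega
  refine mem_saws_iff.2 ⟨?_, fun i hi => ?_, fun i hi => ?_, fun i hi j hj hij => ?_⟩
  · simp [revN, Zd.reverseWalk_apply]
  · simp only [revN, Zd.reverseWalk_apply, Nat.sub_self, Nat.sub_eq_zero_of_le hi]
  · simp only [revN, Zd.reverseWalk_apply]
    rw [adj_negY_sub_iff hpar, show n - i = n - (i + 1) + 1 by omega]
    exact (hbw (n - (i + 1)) (by omega)).symm
  · simp only [Set.mem_setOf_eq] at hi hj
    have h1 := negY_injective hij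
    simp only [Zd.reverseWalk_apply, sub_right_inj] at h1
    have := hinj (show n - i ∈ {i | i ≤ n} by simp) (show n - j ∈ {i | i ≤ n} by simp) h1
    omega

/-- `revN` is an involution on walks from `0` frozen after time `n`. [cite: EntingJensen2009, §7.4.2, Fig. 7.10 (brickwork form of the honeycomb lattice)] -/
theorem revN_revN (h0 : ω 0 = 0) (hend : ∀ i, n ≤ i → ω i = ω n) : revN n (revN n ω) = ω := by
  have h00 : ω 0 0 = 0 := by rw [h0]; rfl
  have h01 : ω 0 1 = 0 := by rw [h0]; rfl
  funext i
  refine funext fun j => ?_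
  revert j
  rw [Fin.forall_fin_two]
  refine ⟨?_, ?_⟩
  · rw [revN_apply_zero, revN_apply_zero, revN_apply_zero, Nat.sub_self]
    rcases le_or_gt i n with hi | hi
    · rw [Nat.sub_sub_self hi, h00]; ring
    · rw [Nat.sub_eq_zero_of_le hi.le, Nat.sub_zero, hend i hi.le, h00]; ring
  · rw [revN_apply_one, revN_apply_one, revN_apply_one, Nat.sub_self]
    rcases le_or_gt i n with hi | hi
    · rw [Nat.sub_sub_self hi, h01]; ring
    · rw [Nat.sub_eq_zero_of_le hi.le, Nat.sub_zero, hend i hi.le, h01]; ring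

/-- The full unfolding does not change second coordinates. [cite: MadrasSlade1993, §3.1 (proof of Proposition 3.1.5)] -/
theorem unfold_apply_one (n : ℕ) (ω : ℕ → Site 2) (i : ℕ) : Zd.unfold n ω i 1 = ω i 1 :=
  Zd.iterate_unfoldStep_apply_of_ne n ω (n + 1) i (by decide)

/-- **The transpose-free two-sided unfolding** `G = unfold ∘ revN ∘ unfold ∘ revN`.
[cite: MadrasSlade1993, §3.1 (proof of Theorem 3.1.1: "c_N ≤ Σ h_{N-m+1} h_{m}" via unfolding both ends); HammersleyTorrieWhittington1982, §2] -/
def G (n : ℕ) (ω : ℕ → Site 2) : ℕ → Site 2 := Zd.unfold n (revN n (Zd.unfold n (revN n ω)))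

/-- `G ω` is a brick-wall SAW with `X` weakly minimal at the start and maximal at the end, and the same
`Y`-coordinates as `ω`. [cite: MadrasSlade1993, §3.1 (proof of Theorem 3.1.1)] -/
theorem G_spec (hω : ω ∈ saws n) (hn : n % 2 = 0) :
    G n ω ∈ saws n ∧ IsWB n (G n ω) ∧ ∀ i ≤ n, G n ω i 1 = ω i 1 := by
  obtain ⟨h0, -, -, -⟩ := mem_saws_iff.1 hω
  have h1 : revN n ω ∈ saws n := revN_mem hω hn
  have h2 : Zd.unfold n (revN n ω) ∈ saws n := unfold_mem h1
  have h3 : revN n (Zd.unfold n (revN n ω)) ∈ saws n := revN_mem h2 hn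
  have h4 : G n ω ∈ saws n := unfold_mem h3
  have hmax2 : ∀ i ≤ n, Zd.unfold n (revN n ω) i 0 ≤ Zd.unfold n (revN n ω) n 0 :=
    fun i hi => Zd.apply_le_unfold_last (saws_subset _ h1) hi
  have hmin3 : ∀ i ≤ n, revN n (Zd.unfold n (revN n ω)) 0 0 ≤ revN n (Zd.unfold n (revN n ω)) i 0 := by
    intro i _
    rw [revN_apply_zero, revN_apply_zero, Nat.sub_zero, sub_self, sub_nonneg]
    exact hmax2 (n - i) (Nat.sub_le _ _)
  refine ⟨h4, fun i hi => ⟨?_, Zd.apply_le_unfold_last (saws_subset _ h3) hi⟩, fun i hi => ?_⟩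
  · exact Zd.weakHalfSpace_iterate_unfoldStep hmin3 (n + 1) i hi
  · rw [G, unfold_apply_one, revN_apply_one, unfold_apply_one, unfold_apply_one, revN_apply_one,
      revN_apply_one, Nat.sub_self, Nat.sub_sub_self hi]
    have : ω 0 1 = 0 := by rw [h0]; rfl
    rw [this]; ring

/-- **`ω ↦ (G ω, code, code)` is injective** on `saws n` (`n` even): each unfolding is undone knowing its code
(`Zd.unfold_code_injOn`), each `revN` is an involution. [cite: MadrasSlade1993, §3.1 (proof of Proposition 3.1.5: "this transformation is one-to-one")] -/
theorem G_codes_injOn (hn : n % 2 = 0) :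
    Set.InjOn (fun ω : ℕ → Site 2 =>
      (G n ω, (Zd.code n (revN n ω), Zd.code n (revN n (Zd.unfold n (revN n ω)))))) ↑(saws n) := by
  intro ω hω ω' hω' h
  simp only [Prod.mk.injEq] at h
  obtain ⟨hG, hc1, hc3⟩ := h
  have hω : ω ∈ saws n := hω
  have hω' : ω' ∈ saws n := hω'
  have h1 := revN_mem hω hn
  have h1' := revN_mem hω' hn
  have h2 := unfold_mem h1
  have h2' := unfold_mem h1'
  have h3 := revN_mem h2 hn
  have h3' := revN_mem h2' hn
  have e3 : revN n (Zd.unfold n (revN n ω)) = revN n (Zd.unfold n (revN n ω')) :=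
    Zd.unfold_code_injOn n (saws_subset _ h3) (saws_subset _ h3')
      (by simp only [Prod.mk.injEq]; exact ⟨hG, hc3⟩)
  have e2 : Zd.unfold n (revN n ω) = Zd.unfold n (revN n ω') := by
    have := congrArg (revN n) e3
    rwa [revN_revN (mem_saws_iff.1 h2).1 (mem_saws_iff.1 h2).2.1,
      revN_revN (mem_saws_iff.1 h2').1 (mem_saws_iff.1 h2').2.1] at this
  have e1 : revN n ω = revN n ω' :=
    Zd.unfold_code_injOn n (saws_subset _ h1) (saws_subset _ h1')
      (by simp only [Prod.mk.injEq]; exact ⟨e2, hc1⟩)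
  have := congrArg (revN n) e1
  obtain ⟨h0, hend, -, -⟩ := mem_saws_iff.1 hω
  obtain ⟨h0', hend', -, -⟩ := mem_saws_iff.1 hω'
  rwa [revN_revN h0 hend, revN_revN h0' hend'] at this

open Classical in
/-- **`#T ≤ e^{6√n} · #(G '' T)`** for every set `T` of `n`-step brick-wall SAWs, `n` even (two codes, each among at most
`e^{3√n}` sets). [cite: MadrasSlade1993, §3.1, (3.1.4)–(3.1.5) and Theorem 3.1.1] -/
theorem card_le_exp_mul_card_image_G {T : Finset (ℕ → Site 2)} (hT : T ⊆ saws n) (hn : n % 2 = 0) :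
    (#T : ℝ) ≤ Real.exp (6 * Real.sqrt n) * #(T.image (G n)) := by
  set C := finsetsOfSumLE n
  have hmaps : ∀ ω ∈ T, (G n ω, (Zd.code n (revN n ω), Zd.code n (revN n (Zd.unfold n (revN n ω))))) ∈
      T.image (G n) ×ˢ (C ×ˢ C) := fun ω hω => by
    have h1 := revN_mem (hT hω) hn
    have h3 := revN_mem (unfold_mem h1) hn
    exact Finset.mem_product.2 ⟨Finset.mem_image_of_mem _ hω, Finset.mem_product.2
      ⟨Zd.code_mem_finsetsOfSumLE (saws_subset _ h1), Zd.code_mem_finsetsOfSumLE (saws_subset _ h3)⟩⟩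
  have hcard := Finset.card_le_card_of_injOn _ hmaps fun ω hω ω' hω' h =>
    G_codes_injOn hn (hT hω) (hT hω') h
  rw [Finset.card_product, Finset.card_product] at hcard
  have hC := card_finsetsOfSumLE_le_exp n
  calc (#T : ℝ) ≤ #(T.image (G n)) * (#C * #C) := by exact_mod_cast hcard
    _ ≤ #(T.image (G n)) * (Real.exp (3 * Real.sqrt n) * Real.exp (3 * Real.sqrt n)) := by gcongr
    _ = Real.exp (6 * Real.sqrt n) * #(T.image (G n)) := by
        rw [← Real.exp_add, show 3 * Real.sqrt n + 3 * Real.sqrt n = 6 * Real.sqrt n by ring, mul_comm]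

/-- `G` maps arches to wall bridges, preserving the visits. [cite: HammersleyTorrieWhittington1982, §2 (unfolding of surface walks)] -/
theorem G_mem_wbr (hω : ω ∈ archs n) : G n ω ∈ wbr n ∧ visits n (G n ω) = visits n ω := by
  obtain ⟨hωh, hn, hend0⟩ := mem_archs.1 hω
  obtain ⟨hωs, hhp⟩ := mem_hpw.1 hωh
  obtain ⟨hG, hwb, hY⟩ := G_spec hωs hn
  refine ⟨mem_wbr.2 ⟨mem_archs.2 ⟨mem_hpw.2 ⟨hG, fun i hi => ?_⟩, hn, ?_⟩, hwb⟩,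
    visits_congr fun i _ hi => hY i hi⟩
  · rw [hY i hi]; exact hhp i hi
  · rw [hY n le_rfl]; exact hend0

open Classical in
/-- **`A_n(y) ≤ e^{6√n} · B^w_n(y)`** (`y ≥ 0`): fibrewise in the number of visits, `G` is at most `e^{6√n}`-to-one
from arches into wall bridges. [cite: HammersleyTorrieWhittington1982, §2; MadrasSlade1993, §3.1, Theorem 3.1.1] -/
theorem Aw_le_exp_mul_WB (n : ℕ) (hy : 0 ≤ y) : Aw n y ≤ Real.exp (6 * Real.sqrt n) * WB n y := by
  rcases Nat.mod_two_eq_zero_or_one n with hn | hn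
  swap
  · rw [Aw_eq_zero_of_odd hn]; exact mul_nonneg (Real.exp_nonneg _) (WB_nonneg n hy)
  have hfA : ∀ ω ∈ archs n, visits n ω ∈ range (n + 1) := fun ω _ =>
    Finset.mem_range.2 (Nat.lt_succ_of_le (visits_le n ω))
  have hfW : ∀ ω ∈ wbr n, visits n ω ∈ range (n + 1) := fun ω _ =>
    Finset.mem_range.2 (Nat.lt_succ_of_le (visits_le n ω))
  rw [Aw, WB, ← Finset.sum_fiberwise_of_maps_to hfA, ← Finset.sum_fiberwise_of_maps_to hfW, Finset.mul_sum]
  refine Finset.sum_le_sum fun v _ => ?_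
  set FA := (archs n).filter (fun ω => visits n ω = v)
  set FW := (wbr n).filter (fun ω => visits n ω = v)
  have hA : ∑ ω ∈ FA, y ^ visits n ω = #FA * y ^ v := by
    rw [Finset.sum_congr rfl fun ω hω => by rw [(Finset.mem_filter.1 hω).2], Finset.sum_const, nsmul_eq_mul]
  have hW : ∑ ω ∈ FW, y ^ visits n ω = #FW * y ^ v := by
    rw [Finset.sum_congr rfl fun ω hω => by rw [(Finset.mem_filter.1 hω).2], Finset.sum_const, nsmul_eq_mul]
  rw [hA, hW]
  have hT : FA ⊆ saws n := (Finset.filter_subset _ _).trans (archs_subset.trans hpw_subset)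
  have himg : FA.image (G n) ⊆ FW := by
    intro ζ hζ
    obtain ⟨ω, hω, rfl⟩ := Finset.mem_image.1 hζ
    obtain ⟨hωa, hv⟩ := Finset.mem_filter.1 hω
    obtain ⟨h1, h2⟩ := G_mem_wbr hωa
    exact Finset.mem_filter.2 ⟨h1, by rw [h2, hv]⟩
  have h1 := card_le_exp_mul_card_image_G hT hn
  have h2 : (#(FA.image (G n)) : ℝ) ≤ #FW := by exact_mod_cast Finset.card_le_card himg
  calc (#FA : ℝ) * y ^ v ≤ (Real.exp (6 * Real.sqrt n) * #FW) * y ^ v := by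
        refine mul_le_mul_of_nonneg_right (h1.trans ?_) (pow_nonneg hy _)
        exact mul_le_mul_of_nonneg_left h2 (Real.exp_nonneg _)
    _ = Real.exp (6 * Real.sqrt n) * (#FW * y ^ v) := by ring

/-! ### The last-visit decomposition: `C^w_n ≤ Σ_k A_k · c_{n-k}(ℍ)` -/

/-- The last surface visit of `ω` in `[0, n]`. [cite: HammersleyTorrieWhittington1982, §2 (decomposition at the last surface contact)] -/
def lastV (n : ℕ) (ω : ℕ → Site 2) : ℕ := Nat.findGreatest (fun i => i % 2 = 0 ∧ ω i 1 = 0) n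

/-- `lastV ≤ n`. [cite: BeatonBousquetMelouDeGierDuminilCopinGuttmann2014, §3.1 (arXiv v5 p. 8: c(ω), the number of contacts with the surface)] -/
theorem lastV_le (n : ℕ) (ω : ℕ → Site 2) : lastV n ω ≤ n := Nat.findGreatest_le n

/-- The last visit is a visit (time `0` is one). [cite: BeatonBousquetMelouDeGierDuminilCopinGuttmann2014, §3.1 (arXiv v5 p. 8: c(ω), the number of contacts with the surface)] -/
theorem lastV_spec (h0 : ω 0 = 0) : lastV n ω % 2 = 0 ∧ ω (lastV n ω) 1 = 0 := by
  have h : (0 : ℕ) % 2 = 0 ∧ ω 0 1 = 0 := ⟨rfl, by rw [h0]; rfl⟩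
  exact Nat.findGreatest_spec (P := fun i => i % 2 = 0 ∧ ω i 1 = 0) (Nat.zero_le n) h

/-- No visit after the last one. [cite: BeatonBousquetMelouDeGierDuminilCopinGuttmann2014, §3.1 (arXiv v5 p. 8: c(ω), the number of contacts with the surface)] -/
theorem not_visit_of_lastV_lt {i : ℕ} (h1 : lastV n ω < i) (h2 : i ≤ n) : ¬ (i % 2 = 0 ∧ ω i 1 = 0) :=
  Nat.findGreatest_is_greatest h1 h2

/-- The prefix up to an even-time surface visit is an arch with the same visits up to that time. [cite: MadrasSlade1993, §1.2, (1.2.3)] -/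
theorem prefixWalk_mem_archs (hω : ω ∈ hpw n) {k : ℕ} (hk : k ≤ n) (hk2 : k % 2 = 0) (hY : ω k 1 = 0) :
    Zd.prefixWalk k ω ∈ archs k ∧ visits k (Zd.prefixWalk k ω) = visits k ω := by
  obtain ⟨hωs, hhp⟩ := mem_hpw.1 hω
  obtain ⟨h0, -, hbw, -⟩ := mem_saws_iff.1 hωs
  have hv : ∀ i ≤ k, Zd.prefixWalk k ω i = ω i := fun i hi => by simp [Zd.prefixWalk, min_eq_left hi]
  refine ⟨mem_archs.2 ⟨mem_hpw.2 ⟨mem_saws.2 ⟨Zd.prefixWalk_mem_saws (saws_subset _ hωs) hk, fun i hi => ?_⟩,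
    fun i hi => ?_⟩, hk2, ?_⟩, visits_congr fun i _ hi => by rw [hv i hi]⟩
  · rw [hv i hi.le, hv (i + 1) (by omega)]; exact hbw i (by omega)
  · rw [hv i hi]; exact hhp i (by omega)
  · rw [hv k le_rfl]; exact hY

/-- The suffix after an even time, re-based at `0`, is a brick-wall SAW (translation by a site of even parity).
[cite: MadrasSlade1993, §1.2, (1.2.3)] -/
theorem suffixWalk_mem (hω : ω ∈ saws n) {k : ℕ} (hk : k ≤ n) (hk2 : k % 2 = 0) :
    Zd.suffixWalk k (n - k) ω ∈ saws (n - k) := by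
  obtain ⟨h0, -, hbw, -⟩ := mem_saws_iff.1 hω
  have hpar : ((-ω k) 0 + (-ω k) 1) % 2 = 0 := by
    have := parity_apply hω hk; simp only [Pi.neg_apply]; omega
  refine mem_saws.2 ⟨Zd.suffixWalk_mem_saws (saws_subset _ hω) (by omega), fun i hi => ?_⟩
  have h1 : Zd.suffixWalk k (n - k) ω i = ω (k + i) + -ω k := by
    simp [Zd.suffixWalk, min_eq_left hi.le, sub_eq_add_neg]
  have h2 : Zd.suffixWalk k (n - k) ω (i + 1) = ω (k + i + 1) + -ω k := by
    simp [Zd.suffixWalk, min_eq_left (Nat.succ_le_of_lt hi), sub_eq_add_neg, add_assoc]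
  rw [h1, h2, adj_add_iff_of_even hpar]
  exact hbw (k + i) (by omega)

open Classical in
/-- The walks with last visit at time `k` weigh at most `A_k(y) · c_{n-k}(ℍ)` (prefix/suffix injection).
[cite: HammersleyTorrieWhittington1982, §2; MadrasSlade1993, §1.2, (1.2.3)] -/
theorem sum_fibre_lastV_le (hy : 0 ≤ y) {k : ℕ} (hk : k ≤ n) :
    ∑ ω ∈ (hpw n).filter (fun ω => lastV n ω = k), y ^ visits n ω ≤ Aw k y * #(saws (n - k)) := by
  set F := (hpw n).filter (fun ω => lastV n ω = k)
  have hF : ∀ ω ∈ F, ω ∈ hpw n ∧ lastV n ω = k := fun ω hω => Finset.mem_filter.1 hω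
  have hprops : ∀ ω ∈ F, visits n ω = visits k (Zd.prefixWalk k ω) ∧
      Zd.prefixWalk k ω ∈ archs k ∧ Zd.suffixWalk k (n - k) ω ∈ saws (n - k) := by
    intro ω hω
    obtain ⟨hωh, hl⟩ := hF ω hω
    have hωs := hpw_subset hωh
    obtain ⟨h0, -, -, -⟩ := mem_saws_iff.1 hωs
    obtain ⟨hk2, hY⟩ := lastV_spec (n := n) h0
    rw [hl] at hk2 hY
    obtain ⟨hpa, hpv⟩ := prefixWalk_mem_archs hωh hk hk2 hY
    refine ⟨?_, hpa, suffixWalk_mem hωs hk hk2⟩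
    have e := visits_add_eq_left (k := k) (b := n - k) (ζ := ω)
      (fun j hj1 hjb => not_visit_of_lastV_lt (n := n) (ω := ω) (by omega) (by omega))
    rw [Nat.add_sub_cancel' hk] at e
    rw [hpv, e]
  have hinj : Set.InjOn (fun ω : ℕ → Site 2 => (Zd.prefixWalk k ω, Zd.suffixWalk k (n - k) ω)) ↑F :=
    fun ω hω ω' hω' h => Zd.prefix_suffix_injOn hk (saws_subset _ (hpw_subset (hF ω hω).1))
      (saws_subset _ (hpw_subset (hF ω' hω').1)) h
  calc ∑ ω ∈ F, y ^ visits n ω = ∑ ω ∈ F, y ^ visits k (Zd.prefixWalk k ω) :=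
        Finset.sum_congr rfl fun ω hω => by rw [(hprops ω hω).1]
    _ = ∑ p ∈ F.image (fun ω => (Zd.prefixWalk k ω, Zd.suffixWalk k (n - k) ω)), y ^ visits k p.1 := by
        rw [Finset.sum_image hinj]
    _ ≤ ∑ p ∈ archs k ×ˢ saws (n - k), y ^ visits k p.1 := by
        refine Finset.sum_le_sum_of_subset_of_nonneg (fun p hp => ?_) fun _ _ _ => pow_nonneg hy _
        obtain ⟨ω, hω, rfl⟩ := Finset.mem_image.1 hp
        exact Finset.mem_product.2 ⟨(hprops ω hω).2.1, (hprops ω hω).2.2⟩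
    _ = Aw k y * #(saws (n - k)) := by
        rw [Finset.sum_product, Aw, Finset.sum_mul]
        refine Finset.sum_congr rfl fun φ _ => ?_
        dsimp only
        rw [Finset.sum_const, nsmul_eq_mul, mul_comm]

open Classical in
/-- **`C^w_n(y) ≤ Σ_{k ≤ n} A_k(y) · c_{n-k}(ℍ)`** (`y ≥ 0`): split at the last surface visit.
[cite: HammersleyTorrieWhittington1982, §2; BeatonBousquetMelouDeGierDuminilCopinGuttmann2014, §3.1, Proposition 5] -/
theorem Cw_le_sum (n : ℕ) (hy : 0 ≤ y) : Cw n y ≤ ∑ k ∈ range (n + 1), Aw k y * #(saws (n - k)) := by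
  have hf : ∀ ω ∈ hpw n, lastV n ω ∈ range (n + 1) := fun ω _ =>
    Finset.mem_range.2 (Nat.lt_succ_of_le (lastV_le n ω))
  rw [Cw, ← Finset.sum_fiberwise_of_maps_to hf]
  exact Finset.sum_le_sum fun k hk => sum_fibre_lastV_le hy (Nat.le_of_lt_succ (Finset.mem_range.1 hk))

/-! ### Fekete: the wall-bridge growth rate `β(y)` -/

/-- A priori bound `B^w_m(y) ≤ μ · (e⁶ μ max(1,y))^m`. [cite: MadrasSlade1993, §1.2 (p. 11); HammersleyWelsh1962, Theorem] -/
theorem WB_le_apriori (m : ℕ) (hy : 0 ≤ y) :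
    WB m y ≤ hexConnectiveConstant * (Real.exp 6 * hexConnectiveConstant * max 1 y) ^ m := by
  have hμ := hexConnectiveConstant_pos
  have h1 := WB_le_card_mul_pow m hy
  have hmm : (m : ℝ) ≤ (m : ℝ) ^ 2 := by
    rcases Nat.eq_zero_or_pos m with rfl | hm
    · simp
    · have : (1 : ℝ) ≤ m := by exact_mod_cast hm
      nlinarith
  have hs : Real.sqrt m ≤ m :=
    calc Real.sqrt m ≤ Real.sqrt ((m : ℝ) ^ 2) := Real.sqrt_le_sqrt hmm
      _ = m := Real.sqrt_sq (Nat.cast_nonneg m)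
  have h2 : (#(saws m) : ℝ) ≤ hexConnectiveConstant * (Real.exp 6 * hexConnectiveConstant) ^ m := by
    rw [card_saws]
    have h := hexSawCount_le_mu_mul_exp_mul_pow m
    have he : Real.exp (6 * Real.sqrt m) ≤ Real.exp 6 ^ m := by
      rw [← Real.exp_nat_mul]
      exact Real.exp_le_exp.2 (by nlinarith)
    calc (hexSawCount m : ℝ) ≤ hexConnectiveConstant * Real.exp (6 * Real.sqrt m) * hexConnectiveConstant ^ m := h
      _ ≤ hexConnectiveConstant * Real.exp 6 ^ m * hexConnectiveConstant ^ m :=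
          mul_le_mul_of_nonneg_right (mul_le_mul_of_nonneg_left he hμ.le) (pow_nonneg hμ.le _)
      _ = hexConnectiveConstant * (Real.exp 6 * hexConnectiveConstant) ^ m := by ring
  calc WB m y ≤ #(saws m) * max 1 y ^ m := h1
    _ ≤ hexConnectiveConstant * (Real.exp 6 * hexConnectiveConstant) ^ m * max 1 y ^ m :=
        mul_le_mul_of_nonneg_right h2 (pow_nonneg (zero_le_one.trans (le_max_left _ _)) _)
    _ = hexConnectiveConstant * (Real.exp 6 * hexConnectiveConstant * max 1 y) ^ m := by ring

/-- `d_k ≤ A · K^k` for `k ≥ 1`. [cite: MadrasSlade1993, §1.2, Lemma 1.2.2 (boundedness hypothesis)] -/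
theorem wallSeq_le (hy : 0 < y) {k : ℕ} (hk : 1 ≤ k) :
    wallSeq y k ≤ (y * hexConnectiveConstant / (Real.exp 6 * hexConnectiveConstant * max 1 y) ^ 2) *
      ((Real.exp 6 * hexConnectiveConstant * max 1 y) ^ 2) ^ k := by
  set L := Real.exp 6 * hexConnectiveConstant * max 1 y
  have hμ := hexConnectiveConstant_pos
  have hL0 : 0 < L := mul_pos (mul_pos (Real.exp_pos 6) hμ) (lt_of_lt_of_le one_pos (le_max_left 1 y))
  have hL1 : L ^ 2 ≠ 0 := pow_ne_zero _ hL0.ne'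
  rw [wallSeq, if_neg (by omega : k ≠ 0)]
  have h := WB_le_apriori (2 * k - 2) hy.le
  have hLk : (L ^ 2) ^ k = L ^ (2 * k - 2) * L ^ 2 := by
    rw [← pow_mul, ← pow_add]; congr 1; omega
  rw [hLk]
  calc y * WB (2 * k - 2) y ≤ y * (hexConnectiveConstant * L ^ (2 * k - 2)) := mul_le_mul_of_nonneg_left h hy.le
    _ = y * hexConnectiveConstant / L ^ 2 * (L ^ (2 * k - 2) * L ^ 2) := by
        rw [div_mul_eq_mul_div, eq_div_iff hL1]; ring

/-- `u_k = -log d_k`. [cite: MadrasSlade1993, §1.2, Lemma 1.2.2] -/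
def wallU (y : ℝ) (k : ℕ) : ℝ := -Real.log (wallSeq y k)

/-- `ℓ(y) = lim_k u_k / k = inf_{k ≥ 1} u_k / k` (Fekete). [cite: MadrasSlade1993, §1.2, Lemma 1.2.2] -/
def wallLogLim (y : ℝ) : ℝ := sInf ((fun k : ℕ => wallU y k / k) '' Set.Ici 1)

/-- **The wall-bridge growth rate `β(y) = exp(-ℓ(y)/2) = lim_k (y B^w_{2k-2}(y))^{1/(2k)}`.**
[cite: HammersleyTorrieWhittington1982, §2 (growth constant of surface bridges); BeatonBousquetMelouDeGierDuminilCopinGuttmann2014, §3.1, Proposition 5] -/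
def wallRate (y : ℝ) : ℝ := Real.exp (-(wallLogLim y) / 2)

/-- `β(y) > 0`. [cite: MadrasSlade1993, §1.2, Lemma 1.2.2] -/
theorem wallRate_pos (y : ℝ) : 0 < wallRate y := Real.exp_pos _

/-- `u` is subadditive. [cite: MadrasSlade1993, §1.2, (1.2.16)–(1.2.17)] -/
theorem wallU_subadditive (hy : 0 < y) : Subadditive (wallU y) := by
  intro p q
  have hp := wallSeq_pos hy p
  have hq := wallSeq_pos hy q
  have h := wallSeq_mul_le hy p q
  have hlog := Real.log_le_log (mul_pos hp hq) h
  rw [Real.log_mul hp.ne' hq.ne'] at hlog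
  simp only [wallU]
  linarith

/-- `u_k / k` is bounded below. [cite: MadrasSlade1993, §1.2, Lemma 1.2.2] -/
theorem wallU_bddBelow (hy : 0 < y) : BddBelow (Set.range fun k : ℕ => wallU y k / k) := by
  set L := Real.exp 6 * hexConnectiveConstant * max 1 y
  set A := y * hexConnectiveConstant / L ^ 2
  set K := L ^ 2
  have hμ := hexConnectiveConstant_pos
  have hL0 : 0 < L := mul_pos (mul_pos (Real.exp_pos 6) hμ) (lt_of_lt_of_le one_pos (le_max_left 1 y))
  have hA : 0 < A := div_pos (mul_pos hy hμ) (pow_pos hL0 2)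
  have hK : 0 < K := pow_pos hL0 2
  refine ⟨-(max (Real.log A) 0 + max (Real.log K) 0), ?_⟩
  rintro _ ⟨k, rfl⟩
  rcases Nat.eq_zero_or_pos k with rfl | hk
  · simp only [Nat.cast_zero, div_zero]
    linarith [le_max_right (Real.log A) 0, le_max_right (Real.log K) 0]
  · have hk' : (0 : ℝ) < k := by exact_mod_cast hk
    have hk1 : (1 : ℝ) ≤ k := by exact_mod_cast hk
    have h1 : wallSeq y k ≤ A * K ^ k := wallSeq_le hy hk
    have h2 := Real.log_le_log (wallSeq_pos hy k) h1
    rw [Real.log_mul hA.ne' (pow_pos hK k).ne', Real.log_pow] at h2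
    rw [le_div_iff₀ hk']
    simp only [wallU]
    have h3 : Real.log A ≤ max (Real.log A) 0 * k := by
      nlinarith [le_max_left (Real.log A) 0, le_max_right (Real.log A) 0]
    have h4 : (k : ℝ) * Real.log K ≤ k * max (Real.log K) 0 :=
      mul_le_mul_of_nonneg_left (le_max_left _ _) hk'.le
    linarith

/-- The Fekete limit is `wallLogLim`. [cite: MadrasSlade1993, §1.2, Lemma 1.2.2] -/
theorem subadditive_lim_eq (hy : 0 < y) : (wallU_subadditive hy).lim = wallLogLim y := by
  rw [wallLogLim, Subadditive.lim]

/-- **`u_k / k → ℓ(y)`** (Fekete). [cite: MadrasSlade1993, §1.2, Lemma 1.2.2] -/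
theorem tendsto_wallU_div (hy : 0 < y) : Tendsto (fun k : ℕ => wallU y k / k) atTop (𝓝 (wallLogLim y)) := by
  rw [← subadditive_lim_eq hy]
  exact (wallU_subadditive hy).tendsto_lim (wallU_bddBelow hy)

/-- **`ℓ(y) ≤ u_k / k`** for `k ≥ 1` (the limit is the infimum). [cite: MadrasSlade1993, §1.2, Lemma 1.2.2, (1.2.6)] -/
theorem wallLogLim_le (hy : 0 < y) {k : ℕ} (hk : k ≠ 0) : wallLogLim y ≤ wallU y k / k := by
  rw [← subadditive_lim_eq hy]
  exact (wallU_subadditive hy).lim_le_div (wallU_bddBelow hy) hk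

/-- **`d_k ≤ (β²)^k`** for every `k`. [cite: MadrasSlade1993, §1.2, (1.2.17)] -/
theorem wallSeq_le_pow (hy : 0 < y) (k : ℕ) : wallSeq y k ≤ (wallRate y ^ 2) ^ k := by
  rcases Nat.eq_zero_or_pos k with rfl | hk
  · simp [wallSeq]
  have h1 := wallLogLim_le hy hk.ne'
  have hk' : (0 : ℝ) < k := by exact_mod_cast hk
  rw [le_div_iff₀ hk', wallU] at h1
  have hβ2 : wallRate y ^ 2 = Real.exp (-(wallLogLim y)) := by
    rw [wallRate, ← Real.exp_nat_mul]; congr 1; push_cast; ring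
  rw [hβ2, ← Real.exp_nat_mul, ← Real.exp_log (wallSeq_pos hy k)]
  exact Real.exp_le_exp.2 (by linarith)

/-- **`B^w_m(y) ≤ (β(y)²/y) · β(y)^m`** for every `m`. [cite: MadrasSlade1993, §1.2, (1.2.17); HammersleyTorrieWhittington1982, §2] -/
theorem WB_le_pow (hy : 0 < y) (m : ℕ) : WB m y ≤ (wallRate y ^ 2 / y) * wallRate y ^ m := by
  have hβ := wallRate_pos y
  rcases Nat.mod_two_eq_zero_or_one m with hm | hm
  · obtain ⟨j, rfl⟩ : ∃ j, m = 2 * j := ⟨m / 2, by omega⟩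
    have h := wallSeq_le_pow hy (j + 1)
    rw [wallSeq, if_neg (by omega : j + 1 ≠ 0), show 2 * (j + 1) - 2 = 2 * j by omega] at h
    have e : (wallRate y ^ 2) ^ (j + 1) = wallRate y ^ 2 * wallRate y ^ (2 * j) := by
      rw [pow_succ, pow_mul]; ring
    rw [e] at h
    rw [div_mul_eq_mul_div, le_div_iff₀ hy]
    linarith
  · rw [WB_eq_zero_of_odd hm]
    exact mul_nonneg (div_nonneg (sq_nonneg _) hy.le) (pow_nonneg hβ.le _)

/-- For `0 < r < β(y)`: eventually `(r²)^k ≤ d_k`. [cite: MadrasSlade1993, §1.2, Lemma 1.2.2] -/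
theorem eventually_pow_le_wallSeq (hy : 0 < y) {r : ℝ} (hr0 : 0 < r) (hr : r < wallRate y) :
    ∀ᶠ k : ℕ in atTop, (r ^ 2) ^ k ≤ wallSeq y k := by
  have hlt : wallLogLim y < -Real.log (r ^ 2) := by
    have h1 : Real.log r < Real.log (wallRate y) := Real.log_lt_log hr0 hr
    rw [wallRate, Real.log_exp] at h1
    rw [Real.log_pow]; push_cast; linarith
  have hev := (tendsto_wallU_div hy).eventually (gt_mem_nhds hlt)
  filter_upwards [hev, Filter.eventually_gt_atTop 0] with k hk hk0
  have hk' : (0 : ℝ) < k := by exact_mod_cast hk0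
  rw [div_lt_iff₀ hk', wallU] at hk
  rw [← Real.exp_log (pow_pos (pow_pos hr0 2) k), ← Real.exp_log (wallSeq_pos hy k), Real.exp_le_exp,
    Real.log_pow]
  linarith

/-- For `0 < r < β(y)`: eventually `(r²/y) · r^{2j} ≤ B^w_{2j}(y)`. [cite: HammersleyTorrieWhittington1982, §2] -/
theorem eventually_mul_pow_le_WB (hy : 0 < y) {r : ℝ} (hr0 : 0 < r) (hr : r < wallRate y) :
    ∀ᶠ j : ℕ in atTop, (r ^ 2 / y) * r ^ (2 * j) ≤ WB (2 * j) y := by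
  have hev := eventually_pow_le_wallSeq hy hr0 hr
  have hj : Tendsto (fun j : ℕ => j + 1) atTop atTop := tendsto_add_atTop_nat 1
  filter_upwards [hj.eventually hev] with j h
  rw [wallSeq, if_neg (by omega : j + 1 ≠ 0), show 2 * (j + 1) - 2 = 2 * j by omega] at h
  rw [div_mul_eq_mul_div, div_le_iff₀ hy]
  calc r ^ 2 * r ^ (2 * j) = (r ^ 2) ^ (j + 1) := by rw [pow_succ, pow_mul]; ring
    _ ≤ y * WB (2 * j) y := h
    _ = WB (2 * j) y * y := mul_comm _ _

/-- **Lower bound for half-plane walks**: for `0 < r < β(y)`, eventually `(r²/y) · min(1, r⁻¹) · r^m ≤ C^w_m(y)`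
(both parities: `B^w_{2j} ≤ C^w_{2j}` and `B^w_{2j} ≤ C^w_{2j+1}`). [cite: HammersleyTorrieWhittington1982, §2] -/
theorem eventually_mul_pow_le_Cw (hy : 0 < y) {r : ℝ} (hr0 : 0 < r) (hr : r < wallRate y) :
    ∀ᶠ m : ℕ in atTop, (r ^ 2 / y * min 1 r⁻¹) * r ^ m ≤ Cw m y := by
  have hev := eventually_mul_pow_le_WB hy hr0 hr
  rw [Filter.eventually_atTop] at hev ⊢
  obtain ⟨J, hJ⟩ := hev
  refine ⟨2 * J, fun m hm => ?_⟩
  have hc0 : 0 ≤ r ^ 2 / y := div_nonneg (sq_nonneg r) hy.le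
  obtain ⟨j, hj⟩ : ∃ j, m = 2 * j ∨ m = 2 * j + 1 := ⟨m / 2, by omega⟩
  rcases hj with rfl | rfl
  · have h := hJ j (by omega)
    calc r ^ 2 / y * min 1 r⁻¹ * r ^ (2 * j) ≤ r ^ 2 / y * 1 * r ^ (2 * j) :=
          mul_le_mul_of_nonneg_right (mul_le_mul_of_nonneg_left (min_le_left _ _) hc0) (pow_nonneg hr0.le _)
      _ = r ^ 2 / y * r ^ (2 * j) := by ring
      _ ≤ WB (2 * j) y := h
      _ ≤ Cw (2 * j) y := WB_le_Cw _ hy.le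
  · have h := hJ j (by omega)
    calc r ^ 2 / y * min 1 r⁻¹ * r ^ (2 * j + 1) ≤ r ^ 2 / y * r⁻¹ * r ^ (2 * j + 1) :=
          mul_le_mul_of_nonneg_right (mul_le_mul_of_nonneg_left (min_le_right _ _) hc0) (pow_nonneg hr0.le _)
      _ = r ^ 2 / y * r ^ (2 * j) := by field_simp; ring
      _ ≤ WB (2 * j) y := h
      _ ≤ Cw (2 * j + 1) y := WB_le_Cw_succ _ hy.le

/-! ### The upper bound `C^w_n(y) ≤ (n+1) (μ β²/y) e^{12√n} max(β, μ)^n` and its exponential form -/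

/-- **`C^w_n(y) ≤ (n+1) · (μ_ℍ β(y)²/y) · e^{12√n} · max(β(y), μ_ℍ)^n`.**
[cite: HammersleyTorrieWhittington1982, §2; BeatonBousquetMelouDeGierDuminilCopinGuttmann2014, §3.1, Proposition 5 ("μ(y) = max(μ, …)")] -/
theorem Cw_le (hy : 0 < y) (n : ℕ) :
    Cw n y ≤ (n + 1) * (hexConnectiveConstant * wallRate y ^ 2 / y) * Real.exp (12 * Real.sqrt n) *
      max (wallRate y) hexConnectiveConstant ^ n := by
  set β := wallRate y
  set μ := hexConnectiveConstant
  set M := max β μ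
  have hβ : 0 < β := wallRate_pos y
  have hμ : 0 < μ := hexConnectiveConstant_pos
  have hM0 : 0 ≤ M := le_max_of_le_left hβ.le
  have hterm : ∀ k ∈ range (n + 1), Aw k y * #(saws (n - k)) ≤
      (μ * β ^ 2 / y) * Real.exp (12 * Real.sqrt n) * M ^ n := by
    intro k hk
    have hkn : k ≤ n := Nat.le_of_lt_succ (Finset.mem_range.1 hk)
    have h1 := Aw_le_exp_mul_WB k hy.le
    have h2 := WB_le_pow hy k
    have h3 : (#(saws (n - k)) : ℝ) ≤ μ * Real.exp (6 * Real.sqrt (n - k : ℕ)) * μ ^ (n - k) := by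
      rw [card_saws]; exact hexSawCount_le_mu_mul_exp_mul_pow (n - k)
    have hs1 : Real.sqrt k ≤ Real.sqrt n := Real.sqrt_le_sqrt (by exact_mod_cast hkn)
    have hs2 : Real.sqrt (n - k : ℕ) ≤ Real.sqrt n := Real.sqrt_le_sqrt (by exact_mod_cast Nat.sub_le n k)
    have e1 : Real.exp (6 * Real.sqrt k) ≤ Real.exp (6 * Real.sqrt n) := Real.exp_le_exp.2 (by linarith)
    have e2 : Real.exp (6 * Real.sqrt (n - k : ℕ)) ≤ Real.exp (6 * Real.sqrt n) := Real.exp_le_exp.2 (by linarith)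
    have hβM : β ^ k ≤ M ^ k := pow_le_pow_left₀ hβ.le (le_max_left _ _) k
    have hμM : μ ^ (n - k) ≤ M ^ (n - k) := pow_le_pow_left₀ hμ.le (le_max_right _ _) _
    have hMM : M ^ k * M ^ (n - k) = M ^ n := by rw [← pow_add, Nat.add_sub_cancel' hkn]
    have hc : 0 ≤ β ^ 2 / y := div_nonneg (sq_nonneg _) hy.le
    calc Aw k y * #(saws (n - k))
        ≤ (Real.exp (6 * Real.sqrt n) * ((β ^ 2 / y) * M ^ k)) *
            (μ * Real.exp (6 * Real.sqrt n) * M ^ (n - k)) := by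
          apply mul_le_mul
          · exact h1.trans (mul_le_mul e1 (h2.trans (mul_le_mul_of_nonneg_left hβM hc))
              (WB_nonneg k hy.le) (Real.exp_nonneg _))
          · exact h3.trans (mul_le_mul (mul_le_mul_of_nonneg_left e2 hμ.le) hμM (pow_nonneg hμ.le _)
              (mul_nonneg hμ.le (Real.exp_nonneg _)))
          · exact Nat.cast_nonneg _
          · exact mul_nonneg (Real.exp_nonneg _) (mul_nonneg hc (pow_nonneg hM0 _))
      _ = (μ * β ^ 2 / y) * (Real.exp (6 * Real.sqrt n) * Real.exp (6 * Real.sqrt n)) * (M ^ k * M ^ (n - k)) := by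
          ring
      _ = (μ * β ^ 2 / y) * Real.exp (12 * Real.sqrt n) * M ^ n := by
          rw [hMM, ← Real.exp_add, show 6 * Real.sqrt n + 6 * Real.sqrt n = 12 * Real.sqrt n by ring]
  calc Cw n y ≤ ∑ k ∈ range (n + 1), Aw k y * #(saws (n - k)) := Cw_le_sum n hy.le
    _ ≤ ∑ k ∈ range (n + 1), (μ * β ^ 2 / y) * Real.exp (12 * Real.sqrt n) * M ^ n := Finset.sum_le_sum hterm
    _ = (n + 1) * (μ * β ^ 2 / y) * Real.exp (12 * Real.sqrt n) * M ^ n := by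
        rw [Finset.sum_const, Finset.card_range, nsmul_eq_mul]; push_cast; ring

/-- Sub-exponential factors are absorbed: for `s > 1`, eventually `exp(c√n) ≤ sⁿ`. [cite: MadrasSlade1993, §3.1 (proof of Theorem 3.1.1)] -/
theorem eventually_exp_sqrt_le_pow {s : ℝ} (hs : 1 < s) (c : ℝ) :
    ∀ᶠ n : ℕ in atTop, Real.exp (c * Real.sqrt n) ≤ s ^ n := by
  have hlog : 0 < Real.log s := Real.log_pos hs
  obtain ⟨N, hN⟩ := exists_nat_ge ((c / Real.log s) ^ 2)
  filter_upwards [Filter.eventually_ge_atTop N] with n hn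
  have hn' : (c / Real.log s) ^ 2 ≤ n := hN.trans (by exact_mod_cast hn)
  rw [← Real.exp_log (pow_pos (zero_lt_one.trans hs) n), Real.exp_le_exp, Real.log_pow]
  have h1 : |c / Real.log s| ≤ Real.sqrt n := Real.abs_le_sqrt hn'
  rw [abs_div, abs_of_pos hlog, div_le_iff₀ hlog] at h1
  have h2 : c * Real.sqrt n ≤ |c| * Real.sqrt n := mul_le_mul_of_nonneg_right (le_abs_self c) (Real.sqrt_nonneg _)
  have h3 : Real.sqrt n * Real.sqrt n = n := Real.mul_self_sqrt (Nat.cast_nonneg n)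
  have h4 := mul_le_mul_of_nonneg_left h1 (Real.sqrt_nonneg n)
  calc c * Real.sqrt n ≤ |c| * Real.sqrt n := h2
    _ = Real.sqrt n * |c| := mul_comm _ _
    _ ≤ Real.sqrt n * (Real.sqrt n * Real.log s) := h4
    _ = n * Real.log s := by rw [← mul_assoc, h3]

/-- For `s > 1` and any constants: eventually `C · exp(c√n) ≤ sⁿ`. [cite: MadrasSlade1993, §3.1 (proof of Theorem 3.1.1)] -/
theorem eventually_mul_exp_sqrt_le_pow {s : ℝ} (hs : 1 < s) (C c : ℝ) :
    ∀ᶠ n : ℕ in atTop, C * Real.exp (c * Real.sqrt n) ≤ s ^ n := by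
  have hs0 : 0 < s := zero_lt_one.trans hs
  rcases le_or_gt C 0 with hC | hC
  · exact Filter.Eventually.of_forall fun n => by
      nlinarith [Real.exp_pos (c * Real.sqrt n), pow_nonneg hs0.le n]
  have h := eventually_exp_sqrt_le_pow hs (|Real.log C| + |c|)
  filter_upwards [h, Filter.eventually_ge_atTop 1] with n hn hn1
  have hsq : 1 ≤ Real.sqrt n := by
    rw [← Real.sqrt_one]; exact Real.sqrt_le_sqrt (by exact_mod_cast hn1)
  calc C * Real.exp (c * Real.sqrt n) = Real.exp (Real.log C + c * Real.sqrt n) := by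
        rw [Real.exp_add, Real.exp_log hC]
    _ ≤ Real.exp ((|Real.log C| + |c|) * Real.sqrt n) := Real.exp_le_exp.2 (by
        nlinarith [mul_nonneg (abs_nonneg (Real.log C)) (sub_nonneg.2 hsq),
          mul_nonneg (sub_nonneg.2 (le_abs_self c)) (Real.sqrt_nonneg n), le_abs_self (Real.log C)])
    _ ≤ s ^ n := hn

/-- **Exponential upper bound: for `r > max(β(y), μ_ℍ)`, eventually `C^w_n(y) ≤ rⁿ`.**
[cite: HammersleyTorrieWhittington1982, §2; BeatonBousquetMelouDeGierDuminilCopinGuttmann2014, §3.1, Proposition 5] -/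
theorem eventually_Cw_le_pow (hy : 0 < y) {r : ℝ} (hr : max (wallRate y) hexConnectiveConstant < r) :
    ∀ᶠ n : ℕ in atTop, Cw n y ≤ r ^ n := by
  set M := max (wallRate y) hexConnectiveConstant
  have hM : 0 < M := lt_max_of_lt_left (wallRate_pos y)
  have hs : 1 < r / M := (one_lt_div hM).2 hr
  set C := hexConnectiveConstant * wallRate y ^ 2 / y
  have hC : 0 ≤ C := div_nonneg (mul_nonneg hexConnectiveConstant_pos.le (sq_nonneg _)) hy.le
  have hn1 : ∀ n : ℕ, ((n : ℝ) + 1) ≤ Real.exp (2 * Real.sqrt n) := fun n => by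
    have h := Real.quadratic_le_exp_of_nonneg (show 0 ≤ 2 * Real.sqrt n by positivity)
    have hsq : Real.sqrt n ^ 2 = n := Real.sq_sqrt (Nat.cast_nonneg n)
    nlinarith [Real.sqrt_nonneg (n : ℝ), Nat.cast_nonneg (α := ℝ) n]
  filter_upwards [eventually_mul_exp_sqrt_le_pow hs C 14] with n hn
  have hMn : 0 < M ^ n := pow_pos hM n
  calc Cw n y ≤ (n + 1) * C * Real.exp (12 * Real.sqrt n) * M ^ n := Cw_le hy n
    _ ≤ Real.exp (2 * Real.sqrt n) * C * Real.exp (12 * Real.sqrt n) * M ^ n :=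
        mul_le_mul_of_nonneg_right (mul_le_mul_of_nonneg_right
          (mul_le_mul_of_nonneg_right (hn1 n) hC) (Real.exp_nonneg _)) hMn.le
    _ = C * Real.exp (14 * Real.sqrt n) * M ^ n := by
        rw [show (14 : ℝ) * Real.sqrt n = 2 * Real.sqrt n + 12 * Real.sqrt n by ring, Real.exp_add]; ring
    _ ≤ (r / M) ^ n * M ^ n := mul_le_mul_of_nonneg_right hn hMn.le
    _ = r ^ n := by rw [div_pow, div_mul_cancel₀ _ hMn.ne']

end Literature.Probability.RandomPlanarGeometry.SAW.HexBW.Wall
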